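import Summits.ResolutionOfSingularities.ResolutionOfSingularities.Theorems.FrobeniusClosingSteerBetaNewtonTransport
import Summits.ResolutionOfSingularities.ResolutionOfSingularities.Theorems.FrobeniusClosingSteerBetaSquareVisibility
import Summits.ResolutionOfSingularities.ResolutionOfSingularities.Theorems.FrobeniusClosingSteerBetaVertexMoves
import HarnessLib

/-!
# Crux `Steer` (stmt-ResolutionOfSingularities-16345), chain W4.1, β-LEAF, K-β2♭ part (II), file 6: the CLEANING TRANSFER
# along the `y`-chart letter — a cleaning dissolving the downstairs vertex lifts to a cleaning dissolving the upstairs vertex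
# (def-free)

OURS (campaign `res-hironaka`, rung L ★L-G4, slot W4.1; statements about the route's own objects; they replace the
role of no printed item and are NOT statements of the manuscript under review [claim: Hironaka2017, status:
under-review]; AI review is weaker than expert review). Seat res-D-pv-003 (gen 7), K-β2♭ kernel owner.

* `not_le_transport_vertex` — no exponent of the downstairs strict ideal `BetaGt (α, α + β − 1)` lies below the transported
  vertex exponent `(αm, (α + β − 1)m, i, j)`.
* `lift_half_exponent` — square-free bookkeeping: if `2c + (a, b₁, 0, 0)` is the transported vertex exponent and
  `2k + b₁ = a + b + d`, `b ≤ 1`, then `2c' + (a, b, 0, 0)` is the vertex exponent for an explicit `c'`.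
* **`cleaning_transfer`** — along `φ x = φ y · x₁`, `φ z = φ y · z₁`, `φ w = φ y · w₁`, `f₁ · (φ y)^d = φ f`, with `f ∈ 𝔪^d`,
  `f₁ ∈ 𝔪₁^d`, `BetaGe (α, β) f`, twist `u = x^a y^b` upstairs with `b ≤ 1` and `u₁ = x₁^a (φ y)^b₁` downstairs,
  `2k + b₁ = a + b + d`, characteristic `2`, PERFECT residue field upstairs:
  `(∃ q₁, BetaGt x₁ (φ y) z₁ w₁ d α (α+β−1) (f₁ + u₁ q₁²)) → ∃ q, BetaGt x y z w d α β (f + u q²)`.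
  Proof: expand `f`, `f₁`, `q₁` over their Cossart–Piltant minimal exponent sets; every vertex exponent of `f` transports to a
  minimal exponent of `f₁` (`transport_vertex_mem_minExponents`), which the downstairs cleaning must cancel, so it is `2c + ε₁`
  (`exists_two_nsmul_add_eq`); hence the upstairs vertex exponent is `2c' + ε` (`b ≤ 1`), and the upstairs vertices are cleaned
  by `exists_add_mul_sq_mem`.

[cite: CossartPiltant2019, Prop. 2.1 and 2.6] [cite: CossartJannsenSaito2020, Lemma 12.2 (4)] No Theses file is imported;
nothing here is a route item or a registration.
-/

noncomputable section

-- `Summit.<S>.<S>.…` duplicates the summit name by design (single-problem summit).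
set_option linter.dupNamespace false

namespace Summit.ResolutionOfSingularities.ResolutionOfSingularities.Theorems.SwitchingDichotomy.BetaNewton

open IsLocalRing
open Literature.AlgebraicGeometry.Resolution
open Literature.AlgebraicGeometry.Resolution.CossartPiltant (uPow uPow_mem_span_uPow uPow_mem_span_uPow_of_le minExponents
  uPow_add uPow_nsmul uPow_single exists_expansion_minExponents coeff_not_mem_of_minimal)
open Summit.ResolutionOfSingularities.ResolutionOfSingularities.Theorems.SwitchingDichotomy.BetaPolygon
open Summit.ResolutionOfSingularities.ResolutionOfSingularities.Theorems.SwitchingDichotomy.BetaLetter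
  (range_four uPow_four monomial_eq_uPow threshold_le_span_uPow)

variable {S S₁ : Type} [CommRing S] [CommRing S₁]

/-! ## §1 Exponent bookkeeping -/

/-- **No exponent of the downstairs `BetaGt (α, α + β − 1)` ideal lies below the transported vertex exponent**
`L a = (αm, (α + β − 1)m, i, j)` of a vertex exponent `a = (αm, βm, i, j)` (`α ≥ 0`, `α + β ≥ 1`, `|a| ≥ d`). [folklore] -/
theorem not_le_transport_vertex {d : ℕ} {α β : ℚ} (hα : 0 ≤ α) (hαβ : 1 ≤ α + β) {a : Fin 4 → ℕ} (hzw : a 2 + a 3 < d)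
    (ha0 : (a 0 : ℚ) = α * ((d - a 2 - a 3 : ℕ) : ℚ)) (ha1 : (a 1 : ℚ) = β * ((d - a 2 - a 3 : ℕ) : ℚ))
    (hdeg : d ≤ a 0 + a 1 + a 2 + a 3) {b : Fin 4 → ℕ}
    (hb : d ≤ b 2 + b 3 ∨ (b 2 + b 3 < d ∧ (⌊α * ((d - b 2 - b 3 : ℕ) : ℚ)⌋₊ + 1 ≤ b 0 ∨
      (⌈α * ((d - b 2 - b 3 : ℕ) : ℚ)⌉₊ ≤ b 0 ∧ ⌊(α + β - 1) * ((d - b 2 - b 3 : ℕ) : ℚ)⌋₊ + 1 ≤ b 1)))) :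
    ¬ b ≤ Function.update a 1 (∑ j ∈ (Finset.univ : Finset (Fin 4)), a j) - d • (Pi.single 1 1 : Fin 4 → ℕ) := by
  intro hle
  obtain ⟨h0, h1, h2, h3⟩ := (le_transport_iff a b d).mp hle
  set m : ℕ := d - a 2 - a 3 with hm
  set s : ℕ := d - b 2 - b 3 with hs
  have hms : m ≤ s := by omega
  have hmsQ : (m : ℚ) ≤ s := by exact_mod_cast hms
  rcases hb with hb | ⟨-, hb | ⟨-, hb⟩⟩
  · omega
  · -- `⌊α s⌋ + 1 ≤ b₀ ≤ a₀ = α m ≤ α s`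
    have h1Q : ((⌊α * (s : ℚ)⌋₊ + 1 : ℕ) : ℚ) ≤ a 0 := by exact_mod_cast hb.trans h0
    push_cast at h1Q
    have hαs : α * (m : ℚ) ≤ α * s := mul_le_mul_of_nonneg_left hmsQ hα
    linarith [Nat.lt_floor_add_one (α * (s : ℚ))]
  · -- `⌊β₁ s⌋ + 1 ≤ b₁ ≤ |a| − d = β₁ m ≤ β₁ s`
    have hsub : ((a 0 + a 1 + a 2 + a 3 - d : ℕ) : ℚ) = (α + β - 1) * m := by
      rw [Nat.cast_sub hdeg]
      push_cast
      have : ((d : ℕ) : ℚ) = m + a 2 + a 3 := by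
        rw [hm]
        have : ((d - a 2 - a 3 : ℕ) : ℚ) = d - a 2 - a 3 := by
          rw [Nat.sub_sub, Nat.cast_sub (by omega)]; push_cast; ring
        linarith
      rw [ha0, ha1, this]; ring
    have h1Q : ((⌊(α + β - 1) * (s : ℚ)⌋₊ + 1 : ℕ) : ℚ) ≤ ((a 0 + a 1 + a 2 + a 3 - d : ℕ) : ℚ) := by
      exact_mod_cast hb.trans h1
    rw [hsub] at h1Q
    push_cast at h1Q
    have hβs : (α + β - 1) * (m : ℚ) ≤ (α + β - 1) * s := mul_le_mul_of_nonneg_left hmsQ (by linarith)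
    linarith [Nat.lt_floor_add_one ((α + β - 1) * (s : ℚ))]

/-- **Square-free bookkeeping of the half-exponents.** If `2c + (a, b₁, 0, 0) = L as` (the transported vertex exponent),
`2k + b₁ = a + b + d`, `b ≤ 1` and `|as| ≥ d`, then `2c' + (a, b, 0, 0) = as` for `c' = (c₀, c₁ + d − k − c₀ − c₂ − c₃, c₂, c₃)`.
[folklore] -/
theorem lift_half_exponent {d a b b₁ k : ℕ} (hbsq : b ≤ 1) (hk : 2 * k + b₁ = a + b + d) {a' : Fin 4 → ℕ}
    (hdeg : d ≤ a' 0 + a' 1 + a' 2 + a' 3) {c : Fin 4 → ℕ}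
    (hc : 2 • c + ![a, b₁, 0, 0] =
      Function.update a' 1 (∑ j ∈ (Finset.univ : Finset (Fin 4)), a' j) - d • (Pi.single 1 1 : Fin 4 → ℕ)) :
    2 • (![c 0, c 1 + d - (k + c 0 + c 2 + c 3), c 2, c 3] : Fin 4 → ℕ) + ![a, b, 0, 0] = a' := by
  obtain ⟨e0, e1, e2, e3⟩ := transport_apply a' d
  have k0 := congrFun hc 0; have k1 := congrFun hc 1; have k2 := congrFun hc 2; have k3 := congrFun hc 3
  simp only [Pi.add_apply, Pi.smul_apply, smul_eq_mul, Matrix.cons_val_zero, Matrix.cons_val_one,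
    Matrix.cons_val] at k0 k1 k2 k3
  rw [e0] at k0; rw [e1] at k1; rw [e2] at k2; rw [e3] at k3
  funext l
  fin_cases l <;> simp <;> omega

/-! ## §2 The cleaning transfer -/

/-- **CLEANING TRANSFER along the `y`-chart letter.** In characteristic `2`, with a PERFECT residue field upstairs, along
`φ x = φ y · x₁`, `φ z = φ y · z₁`, `φ w = φ y · w₁`, `f₁ · (φ y)^d = φ f`, `f ∈ 𝔪^d`, `f₁ ∈ 𝔪₁^d`, `BetaGe (α, β) f`
(`α, β ≥ 0`), with SQUARE-FREE `y`-exponent of the twist (`u = x^a y^b`, `b ≤ 1`; `u₁ = x₁^a (φ y)^b₁`, `2k + b₁ = a + b + d`):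
a cleaning `q₁` putting `f₁ + u₁ q₁²` strictly beyond `(α, α + β − 1)` lifts to a cleaning `q` putting `f + u q²` strictly beyond
`(α, β)`. [cite: CossartJannsenSaito2020, Lemma 12.2 (4)] [cite: CossartPiltant2019, Prop. 2.6] -/
theorem cleaning_transfer [IsLocalRing S] [CharP S 2] [IsLocalRing S₁] [CharP S₁ 2]
    (hperf : PerfectField (ResidueField S)) (φ : S →+* S₁) {x y z w : S} {x₁ z₁ w₁ : S₁}
    (ht : IsRsopPart ![x, y, z, w]) (ht' : IsRsopPart ![x₁, φ y, z₁, w₁])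
    (hspan : Ideal.span {x, y, z, w} = maximalIdeal S) (hspan₁ : Ideal.span {x₁, φ y, z₁, w₁} = maximalIdeal S₁)
    (hx : φ x = φ y * x₁) (hz : φ z = φ y * z₁) (hw : φ w = φ y * w₁) {d : ℕ} {f : S} {f₁ : S₁}
    (hfd : f ∈ maximalIdeal S ^ d) (hf : f₁ * φ y ^ d = φ f) (hf₁d : f₁ ∈ maximalIdeal S₁ ^ d)
    {α β : ℚ} (hα : 0 ≤ α) (hβ : 0 ≤ β) (hG : BetaGe x y z w d α β f)
    {a b b₁ k : ℕ} (hbsq : b ≤ 1) (hk : 2 * k + b₁ = a + b + d)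
    (h₁ : ∃ q₁ : S₁, BetaGt x₁ (φ y) z₁ w₁ d α (α + β - 1) (f₁ + x₁ ^ a * φ y ^ b₁ * q₁ ^ 2)) :
    ∃ q : S, BetaGt x y z w d α β (f + x ^ a * y ^ b * q ^ 2) := by
  classical
  haveI := ht.isRegularLocalRing
  haveI := ht'.isRegularLocalRing
  obtain ⟨q₁, hq₁⟩ := h₁
  -- expansions over the minimal exponent sets
  obtain ⟨hA, hfA, hminA⟩ := ht.minExponents_spec f
  obtain ⟨γ, hγf⟩ := exists_expansion_minExponents ![x, y, z, w] hfA
  obtain ⟨hA₁, hfA₁, hminA₁⟩ := ht'.minExponents_spec f₁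
  obtain ⟨γ₁, hγ₁f⟩ := exists_expansion_minExponents ![x₁, φ y, z₁, w₁] hfA₁
  have hγ₁u := coeff_not_mem_of_minimal _ hA₁ hminA₁ hγ₁f
  obtain ⟨hQ, hqQ, hminQ⟩ := ht'.minExponents_spec q₁
  obtain ⟨η, hηq⟩ := exists_expansion_minExponents ![x₁, φ y, z₁, w₁] hqQ
  have hηu := coeff_not_mem_of_minimal _ hQ hminQ hηq
  have hGs := (betaGe_iff_forall_minExponents ht hα hβ f).mp hG
  have hdegA := (mem_pow_iff_forall_minExponents ht hspan d f).mp hfd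
  -- vertex exponents: those NOT satisfying the strict condition
  have hvert : ∀ c ∈ minExponents ![x, y, z, w] f,
      ¬ (d ≤ c 2 + c 3 ∨ ⌊α * ((d - c 2 - c 3 : ℕ) : ℚ)⌋₊ + 1 ≤ c 0 ∨
        (⌈α * ((d - c 2 - c 3 : ℕ) : ℚ)⌉₊ ≤ c 0 ∧ ⌊β * ((d - c 2 - c 3 : ℕ) : ℚ)⌋₊ + 1 ≤ c 1)) →
      c 2 + c 3 < d ∧ ((c 0 : ℚ) = α * ((d - c 2 - c 3 : ℕ) : ℚ)) ∧ ((c 1 : ℚ) = β * ((d - c 2 - c 3 : ℕ) : ℚ)) :=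
    fun c hc hPc => exponent_eq_of_betaGe_of_not_betaGt hα hβ (hGs c hc) hPc
  -- the twist exponent upstairs
  have hε : uPow ![x, y, z, w] ![a, b, 0, 0] = x ^ a * y ^ b := by rw [uPow_four]; simp
  by_cases hex : ∃ c ∈ minExponents ![x, y, z, w] f,
      ¬ (d ≤ c 2 + c 3 ∨ ⌊α * ((d - c 2 - c 3 : ℕ) : ℚ)⌋₊ + 1 ≤ c 0 ∨
        (⌈α * ((d - c 2 - c 3 : ℕ) : ℚ)⌉₊ ≤ c 0 ∧ ⌊β * ((d - c 2 - c 3 : ℕ) : ℚ)⌋₊ + 1 ≤ c 1))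
  swap
  · -- no vertex: `f` itself is strictly beyond `(α, β)`
    refine ⟨0, ?_⟩
    rw [zero_pow two_ne_zero, mul_zero, add_zero]
    refine mem_of_forall_minExponents_uPow_mem ht fun c hc => uPow_mem_betaGtIdeal x y z w d α β ?_
    by_contra hPc
    exact hex ⟨c, hc, hPc⟩
  obtain ⟨av, hav, hPav⟩ := hex
  obtain ⟨hzwv, hav0, hav1⟩ := hvert av hav hPav
  have hdegv : d ≤ av 0 + av 1 + av 2 + av 3 := by rw [← sum_four]; exact hdegA av hav
  have hαβ : 1 ≤ α + β := add_ge_one_of_vertex hzwv hav0 hav1 hdegv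
  -- the downstairs element `f₁ + u₁ q₁²` expanded, inside the downstairs strict monomial ideal
  have hε₁ : uPow ![x₁, φ y, z₁, w₁] ![a, b₁, 0, 0] = x₁ ^ a * φ y ^ b₁ := by rw [uPow_four]; simp
  have hmem : ∑ m ∈ minExponents ![x₁, φ y, z₁, w₁] f₁, γ₁ m * uPow ![x₁, φ y, z₁, w₁] m +
      ∑ c ∈ minExponents ![x₁, φ y, z₁, w₁] q₁, η c ^ 2 * uPow ![x₁, φ y, z₁, w₁] (2 • c + ![a, b₁, 0, 0]) ∈
      Ideal.span (uPow ![x₁, φ y, z₁, w₁] ''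
        {m | d ≤ m 2 + m 3 ∨ (m 2 + m 3 < d ∧ (⌊α * ((d - m 2 - m 3 : ℕ) : ℚ)⌋₊ + 1 ≤ m 0 ∨
          (⌈α * ((d - m 2 - m 3 : ℕ) : ℚ)⌉₊ ≤ m 0 ∧ ⌊(α + β - 1) * ((d - m 2 - m 3 : ℕ) : ℚ)⌋₊ + 1 ≤ m 1)))}) := by
    have h2 := mul_sq_expansion ![x₁, φ y, z₁, w₁] (minExponents ![x₁, φ y, z₁, w₁] q₁) η id ![a, b₁, 0, 0]
    simp only [id] at h2
    have hexp : f₁ + x₁ ^ a * φ y ^ b₁ * q₁ ^ 2 =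
        ∑ m ∈ minExponents ![x₁, φ y, z₁, w₁] f₁, γ₁ m * uPow ![x₁, φ y, z₁, w₁] m +
          ∑ c ∈ minExponents ![x₁, φ y, z₁, w₁] q₁, η c ^ 2 * uPow ![x₁, φ y, z₁, w₁] (2 • c + ![a, b₁, 0, 0]) := by
      rw [← h2, ← hηq, hε₁, ← hγ₁f]
    rw [← hexp]
    exact threshold_le_span_uPow x₁ (φ y) z₁ w₁ d
      (fun n a b => ⌊α * (n : ℚ)⌋₊ + 1 ≤ a ∨ (⌈α * (n : ℚ)⌉₊ ≤ a ∧ ⌊(α + β - 1) * (n : ℚ)⌋₊ + 1 ≤ b))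
      (betaGt_le_threshold x₁ (φ y) z₁ w₁ d α (α + β - 1) hq₁)
  -- every vertex exponent of `f` is admissible for the twist `(a, b, 0, 0)`
  have hadm : ∀ c ∈ minExponents ![x, y, z, w] f,
      ¬ (d ≤ c 2 + c 3 ∨ ⌊α * ((d - c 2 - c 3 : ℕ) : ℚ)⌋₊ + 1 ≤ c 0 ∨
        (⌈α * ((d - c 2 - c 3 : ℕ) : ℚ)⌉₊ ≤ c 0 ∧ ⌊β * ((d - c 2 - c 3 : ℕ) : ℚ)⌋₊ + 1 ≤ c 1)) →
      ∃ c' : Fin 4 → ℕ, 2 • c' + ![a, b, 0, 0] = c := by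
    intro c hc hPc
    obtain ⟨hzw, hc0, hc1⟩ := hvert c hc hPc
    have hdeg : d ≤ c 0 + c 1 + c 2 + c 3 := by rw [← sum_four]; exact hdegA c hc
    obtain ⟨hLc, -⟩ := transport_vertex_mem_minExponents φ ht ht' hspan hspan₁ hx hz hw hfd hf hf₁d hα hβ hG hc
      hzw hc0 hc1
    obtain ⟨c₀, -, hc₀⟩ := exists_two_nsmul_add_eq ht' hA₁ hγ₁u hηu ![a, b₁, 0, 0] hmem hLc
      (fun b hb => not_le_transport_vertex hα hαβ hzw hc0 hc1 hdeg hb)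
    exact ⟨_, lift_half_exponent hbsq hk hdeg hc₀⟩
  -- clean the vertices upstairs
  obtain ⟨q, hq⟩ := exists_add_mul_sq_mem hperf ![x, y, z, w] hγf
    (fun c => ¬ (d ≤ c 2 + c 3 ∨ ⌊α * ((d - c 2 - c 3 : ℕ) : ℚ)⌋₊ + 1 ≤ c 0 ∨
      (⌈α * ((d - c 2 - c 3 : ℕ) : ℚ)⌉₊ ≤ c 0 ∧ ⌊β * ((d - c 2 - c 3 : ℕ) : ℚ)⌋₊ + 1 ≤ c 1)))
    (fun c _ hPc => uPow_mem_betaGtIdeal x y z w d α β (not_not.mp hPc))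
    (fun c hc hPc s hs => by
      obtain ⟨hzw, hc0, hc1⟩ := hvert c hc hPc
      exact mul_uPow_vertex_mem_betaGtIdeal hspan hα hβ hαβ hzw hc0 hc1 hs)
    ![a, b, 0, 0] hadm
  exact ⟨q, by rw [← hε]; exact hq⟩

end Summit.ResolutionOfSingularities.ResolutionOfSingularities.Theorems.SwitchingDichotomy.BetaNewton

end
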